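import Summits.BirchSwinnertonDyer.BirchSwinnertonDyer.Theorems.AlignedTransportAtTwoMainConjectureOfRankZeroBSDAtTwoCubicRelationDoor
import Literature.NumberTheory.IwasawaTheory.ClassicalMuVanishesLayerTwoGeneralRelationCertificateTwoSplit
import HarnessLib

/-!
# Route `AlignedTransportAtTwo`, crux C2 `MainConjectureOfRankZeroBSDAtTwo` (stmt-BirchSwinnertonDyer-22298):
# THE GENERAL LAYER-TWO RELATION DOOR IN COORDINATES ON THE SPLIT STRATUM `Δ_min ≡ 1 (mod 8)` — `μ₂ = 0`, `λ₂ ≤ d`, `rank₂ Cl(K_m) ≤ d ∀ m` for the cubic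
# `2`-torsion field `ℚ(β)` (three primes above `2`, `h(ℚ(β))` odd, ONE unit `≡ ±3 (mod 𝔭'³)`), from ONE relation row `∏_{i<4} σ^i(c)^{eᵢ} = 1` of ANY shape
# `Σ eᵢXⁱ = (X−1)^d u + 2g`, `d ≤ 2`, at layer `K_2 = ℚ(β)·ℚ(ζ₁₆)⁺` (degree `12`) written in `𝓞_{ℚ(β)}`

HONEST FRAMING (cell `bsd-f1-sign2`, WIDTH-5 attached prover seat `bsd-line-att-p4` gen 46 on line `birth` of the lead `bsd-line-att-p2`;
`--supports` stmt-BirchSwinnertonDyer-22298, closes nothing; BSD is NOT proved by any of this; the crux C2, its verdict «blocked-on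
`Rank1Residual.GreenbergMuConjectureIrreducible`» and every registered stub are untouched).  THEOREMS ONLY — no definition, no named fact, no `sorry`.

WHAT.  The `W`-level form of this seat's Literature theorem `IwasawaTheory.classicalMuVanishes_two_of_generalRelationCert_layer_two_of_sub_three_mem`
(`ClassicalMuVanishesLayerTwoGeneralRelationCertificateTwoSplit`, the layer-TWO sister of att-p4 g43's general layer-three certificate in the split setting):
`W` good ordinary at `2`, no rational `2`-torsion abscissa, **`Δ_min ≡ 1 (8)`**, `Δ_W < 0`, `β` a root of the `2`-division cubic, `K = ℚ(β)` with `h_K` odd, `2 ∤ d_K`;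
`𝔭'` of norm `2` and a unit **`ε' ≡ ±3 (mod 𝔭'³)`**; `𝔭₁` of norm `2`, a unit `ε ≡ ±1 (mod 𝔭₁³)` with `±ε` non-squares; RELATION ROW DATA in `𝓞_K`: `q₀` with `(q₀)`
maximal, `q₀ ≡ ±3 (mod 𝔭₁³)`, `t ∈ ℤ`, `ψ : 𝓞_K → ℤ/q` with `ψ(q₀) = 0`, `P₂(t) = 0`, Bézout data `α q₀⁴ + β P₂(t) = q₀` and the three coprimality witnesses
`α_k q₀ + v_k p_k(t) = 1` (`p_k = t³ − 4t, −2t, −t³ + 2t`), exponents `e₀..e₃` (`Σ = n`, `Σ eᵢXⁱ = (X−1)^d u + 2g`, `u(1)` odd, `d + 2 ≤ 4`), ONE element `y` (four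
coordinates on `1, s₁, s₂, s₁s₂`) with the four power-membership certificates `y ∈ σ^i(𝔮)^{eᵢ}` (universally quantified ring identities) and the norm
`N_{K_2/K}(y) = ε_y q₀ⁿ`.  THEN for EVERY cyclotomic `ℤ₂`-extension `κ` of `ℚ(β)`: **`rank₂ Cl(K_m) ≤ d ∀ m`, `μ₂(κ) = 0`, `λ₂(κ) ≤ d`.**
HABITAT: the split-stratum seeds of att-p3 g53's census with `h(ℚ(β)) = 1`, `r = 1`, in particular the `λ₂ = 1` fields `−1559` (`10913b1`), `−2071` (`2071a1`)
where the LINEAR relation `c³·σc = 1` holds at layer two (this gen's rows).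

CELL READING: nothing about any curve is asserted HERE; BSD is not proved; nothing is closed.

References: [Washington1997] §13.1, §13.3 Lemmas 13.15, 13.18, Prop. 13.22–13.23; [Lang1990] Ch. 13 §4 Lemma 4.1; [Gras2003] IV.4; [Fukuda1994] Thm. 1;
[NeukirchANT1999] Ch. I §3, §8, Ch. III (1.6)–(1.7); [Omeara1963] §63B (63:10); [Cohen1993] §4.7, §6.5; tree: att-p3 g53 `…CubicSplitStratumRelationDoor`,
this seat's `…CubicSplitStratumLayerTwoRelationDoor` (fixed shape) and `Literature/…/ClassicalMuVanishesLayerTwoGeneralRelationCertificateTwoSplit`,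
att-p4 g43 `…CubicLayerThreeGeneralRelationDoor` (layer-three analogue), att-p5 g26 `…CubicKilfordPrimes`.
-/

set_option linter.dupNamespace false
set_option autoImplicit false

noncomputable section

open scoped Classical NumberField nonZeroDivisors

namespace Summit.BirchSwinnertonDyer.BirchSwinnertonDyer.Theorems.AlignedTransportAtTwoCubicSplitStratumLayerTwoGeneralRelationDoor

open NumberField IsDedekindDomain Polynomial WeierstrassCurve IntermediateField CongruenceSubgroup Finset
  Literature.NumberTheory.IwasawaTheory Literature.NumberTheory.GaloisRepresentations
  Literature.NumberTheory.GaloisRepresentations.Herbrand Literature.NumberTheory.GaloisRepresentations.MinkowskiUnit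
  Literature.NumberTheory.GaloisRepresentations.CyclicNormIndex
  Literature.NumberTheory.EllipticCurves Literature.NumberTheory.EllipticCurves.Greenberg1999
  Literature.NumberTheory.EllipticCurves.ModularForms
  Literature.NumberTheory.EllipticCurves.Rank1Residual
  Literature.NumberTheory.EllipticCurves.Module
  Literature.NumberTheory.NumberFields Literature.NumberTheory.NumberFields.AmbiguousClass
  Summit.BirchSwinnertonDyer.Rank1Residual
  Summit.BirchSwinnertonDyer.Rank1Residual.X1.MuLambda
  Summit.BirchSwinnertonDyer.Rank1Residual.X5
  Summit.BirchSwinnertonDyer.Rank1Residual.F1Sign2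
  Summit.BirchSwinnertonDyer.BirchSwinnertonDyer.Theorems.Rank1ResidualX1Defs
  Summit.BirchSwinnertonDyer.BirchSwinnertonDyer.Theses.AlignedTransportAtTwo
  Summit.BirchSwinnertonDyer.BirchSwinnertonDyer.Theorems.AlignedTransportAtTwoKilfordStratumShared
  Summit.BirchSwinnertonDyer.BirchSwinnertonDyer.Theorems.AlignedTransportAtTwoCubicCarrierRoad
  Summit.BirchSwinnertonDyer.BirchSwinnertonDyer.Theorems.AlignedTransportAtTwoCubicKilfordPrimes
  Summit.BirchSwinnertonDyer.BirchSwinnertonDyer.Theorems.AlignedTransportAtTwoCubicDepthDoorGenusCert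
  Summit.BirchSwinnertonDyer.BirchSwinnertonDyer.Theorems.AlignedTransportAtTwoCubicPrimesOfEmbeddings
  Summit.BirchSwinnertonDyer.BirchSwinnertonDyer.Theorems.AlignedTransportAtTwoCubicLayerOneDoors

variable (W : WeierstrassCurve ℚ) [W.IsElliptic] [W.IsGloballyMinimal]

set_option synthInstance.maxHeartbeats 400000 in
set_option maxHeartbeats 1600000 in
/-- **THE GENERAL LAYER-TWO RELATION DOOR IN COORDINATES ON THE SPLIT STRATUM** for the cubic `2`-torsion field `K = ℚ(β)` (`Δ_min ≡ 1 (8)`: three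
dyadic primes; `Δ_W < 0`, `h_K` odd, `2 ∤ d_K`; ONE unit `ε' ≡ ±3 (mod 𝔭'³)` at a norm-`2` ideal `𝔭'`; a norm-`2` ideal `𝔭₁` with a unit `ε ≡ ±1 (mod 𝔭₁³)`,
`±ε` non-squares): from the displayed general relation-row data in `𝓞_K` (ANY exponents `e₀..e₃` with `Σ eᵢXⁱ = (X−1)^d u + 2g`, `d + 2 ≤ 4`; see the module
docstring) — **`rank₂ Cl(K_m) ≤ d ∀ m`, `μ₂(κ) = 0`, `λ₂(κ) ≤ d` for every cyclotomic `ℤ₂`-extension `κ` of `K`.**  Three dyadic primes, `𝓞_K/𝔭 = 𝔽₂` and «all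
units `≡ ±1 (mod 𝔭₁³)`» (unit rank one) as in `…CubicSplitStratumRelationDoor`; then this seat's
`IwasawaTheory.classicalMuVanishes_two_of_generalRelationCert_layer_two_of_sub_three_mem`. [cite: Washington1997, §13.3 Lemmas 13.15, 13.18, Prop. 13.22–13.23]
[cite: Lang1990, Ch. 13 §4, Lemma 4.1 (PDF pp. 203–204)] [cite: NeukirchANT1999, Ch. III (1.6)–(1.7); Ch. I §3 (3.3)] [cite: Omeara1963, §63B (63:10)] [cite: Cohen1993, §4.7, §6.5] -/
theorem classicalMuVanishes_adjoin_of_generalRelationCert_layer_two_splitStratum (hord : IsOrdinaryAt W 2)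
    (ht : ∀ x : ℚ, ¬ HasRationalTwoTorsionX W x) (h81 : minimalDiscriminantInt W % 8 = 1) (hΔ : W.Δ < 0)
    {β : AlgebraicClosure ℚ} (hβ : aeval β W.twoTorsionPolynomial.toPoly = 0)
    (hh : haveI : FiniteDimensional ℚ ↥(IntermediateField.adjoin ℚ ({β} : Set (AlgebraicClosure ℚ))) :=
        IntermediateField.adjoin.finiteDimensional ((AlgebraicClosure.isAlgebraic ℚ).isAlgebraic β).isIntegral
      haveI : NumberField ↥(IntermediateField.adjoin ℚ ({β} : Set (AlgebraicClosure ℚ))) := NumberField.mk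
      ¬ 2 ∣ classNumber ↥(IntermediateField.adjoin ℚ ({β} : Set (AlgebraicClosure ℚ))))
    (hd : haveI : FiniteDimensional ℚ ↥(IntermediateField.adjoin ℚ ({β} : Set (AlgebraicClosure ℚ))) :=
        IntermediateField.adjoin.finiteDimensional ((AlgebraicClosure.isAlgebraic ℚ).isAlgebraic β).isIntegral
      haveI : NumberField ↥(IntermediateField.adjoin ℚ ({β} : Set (AlgebraicClosure ℚ))) := NumberField.mk
      ¬ (2 : ℤ) ∣ NumberField.discr ↥(IntermediateField.adjoin ℚ ({β} : Set (AlgebraicClosure ℚ))))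
    (𝔭' : Ideal (𝓞 ↥(IntermediateField.adjoin ℚ ({β} : Set (AlgebraicClosure ℚ)))))
    (hN' : haveI : FiniteDimensional ℚ ↥(IntermediateField.adjoin ℚ ({β} : Set (AlgebraicClosure ℚ))) :=
        IntermediateField.adjoin.finiteDimensional ((AlgebraicClosure.isAlgebraic ℚ).isAlgebraic β).isIntegral
      haveI : NumberField ↥(IntermediateField.adjoin ℚ ({β} : Set (AlgebraicClosure ℚ))) := NumberField.mk
      Ideal.absNorm 𝔭' = 2)
    {ε' : (𝓞 ↥(IntermediateField.adjoin ℚ ({β} : Set (AlgebraicClosure ℚ))))ˣ}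
    (hε' : (ε' : 𝓞 ↥(IntermediateField.adjoin ℚ ({β} : Set (AlgebraicClosure ℚ)))) - 3 ∈ 𝔭' ^ 3 ∨
      (ε' : 𝓞 ↥(IntermediateField.adjoin ℚ ({β} : Set (AlgebraicClosure ℚ)))) + 3 ∈ 𝔭' ^ 3)
    (𝔭₁ : Ideal (𝓞 ↥(IntermediateField.adjoin ℚ ({β} : Set (AlgebraicClosure ℚ)))))
    (hN : haveI : FiniteDimensional ℚ ↥(IntermediateField.adjoin ℚ ({β} : Set (AlgebraicClosure ℚ))) :=
        IntermediateField.adjoin.finiteDimensional ((AlgebraicClosure.isAlgebraic ℚ).isAlgebraic β).isIntegral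
      haveI : NumberField ↥(IntermediateField.adjoin ℚ ({β} : Set (AlgebraicClosure ℚ))) := NumberField.mk
      Ideal.absNorm 𝔭₁ = 2)
    {ε : (𝓞 ↥(IntermediateField.adjoin ℚ ({β} : Set (AlgebraicClosure ℚ))))ˣ} (hε : (ε : 𝓞 ↥(IntermediateField.adjoin ℚ ({β} : Set (AlgebraicClosure ℚ)))) - 1 ∈ 𝔭₁ ^ 3 ∨ (ε : 𝓞 ↥(IntermediateField.adjoin ℚ ({β} : Set (AlgebraicClosure ℚ)))) + 1 ∈ 𝔭₁ ^ 3) (hnsq : ∀ z : (𝓞 ↥(IntermediateField.adjoin ℚ ({β} : Set (AlgebraicClosure ℚ))))ˣ, ε ≠ z ^ 2 ∧ ε ≠ -z ^ 2)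
    (κP : ZpExtension ↥(IntermediateField.adjoin ℚ ({β} : Set (AlgebraicClosure ℚ))) 2) (hκP : κP.IsCyclotomic)
    (q₀ : 𝓞 ↥(IntermediateField.adjoin ℚ ({β} : Set (AlgebraicClosure ℚ)))) (hq₀ : (Ideal.span {q₀}).IsMaximal) (hπ : q₀ - 3 ∈ 𝔭₁ ^ 3 ∨ q₀ + 3 ∈ 𝔭₁ ^ 3)
    (t : ℤ) {q : ℕ} (hq : 1 < q) (ψ : 𝓞 ↥(IntermediateField.adjoin ℚ ({β} : Set (AlgebraicClosure ℚ))) →+* ZMod q) (hψ : ψ q₀ = 0) {ti : ZMod q} (hti : 2 * ti = 1)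
    (hPt : ((t : ZMod q) ^ 2 - 2) ^ 2 - 2 = 0)
    (α β' : 𝓞 ↥(IntermediateField.adjoin ℚ ({β} : Set (AlgebraicClosure ℚ)))) (hBez : α * q₀ ^ 4 + β' * (((t : 𝓞 ↥(IntermediateField.adjoin ℚ ({β} : Set (AlgebraicClosure ℚ)))) ^ 2 - 2) ^ 2 - 2) = q₀)
    (α₁ v₁ : 𝓞 ↥(IntermediateField.adjoin ℚ ({β} : Set (AlgebraicClosure ℚ)))) (hC₁ : α₁ * q₀ + v₁ * ((-4) * (t : 𝓞 ↥(IntermediateField.adjoin ℚ ({β} : Set (AlgebraicClosure ℚ)))) + (t : 𝓞 ↥(IntermediateField.adjoin ℚ ({β} : Set (AlgebraicClosure ℚ)))) ^ 3) = 1)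
    (α₂ v₂ : 𝓞 ↥(IntermediateField.adjoin ℚ ({β} : Set (AlgebraicClosure ℚ)))) (hC₂ : α₂ * q₀ + v₂ * ((-2) * (t : 𝓞 ↥(IntermediateField.adjoin ℚ ({β} : Set (AlgebraicClosure ℚ))))) = 1)
    (α₃ v₃ : 𝓞 ↥(IntermediateField.adjoin ℚ ({β} : Set (AlgebraicClosure ℚ)))) (hC₃ : α₃ * q₀ + v₃ * (2 * (t : 𝓞 ↥(IntermediateField.adjoin ℚ ({β} : Set (AlgebraicClosure ℚ)))) + (-1) * (t : 𝓞 ↥(IntermediateField.adjoin ℚ ({β} : Set (AlgebraicClosure ℚ)))) ^ 3) = 1)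
    (e₀ e₁ e₂ e₃ : ℕ) {n d : ℕ} (hn : e₀ + e₁ + e₂ + e₃ = n) (hd2 : d + 2 ≤ 4) {u g : ℤ[X]} (hu : ¬ (2 : ℤ) ∣ u.eval 1)
    (hF : (C (e₀ : ℤ) + C (e₁ : ℤ) * X + C (e₂ : ℤ) * X ^ 2 + C (e₃ : ℤ) * X ^ 3 : ℤ[X]) = (X - 1) ^ d * u + C (2 : ℤ) * g)
    (y₀ y₁ y₂ y₃ : 𝓞 ↥(IntermediateField.adjoin ℚ ({β} : Set (AlgebraicClosure ℚ))))
    (hmem₀ : ∀ (R : Type) [CommRing R] (φ : 𝓞 ↥(IntermediateField.adjoin ℚ ({β} : Set (AlgebraicClosure ℚ))) →+* R) (S₁ S₂ : R), S₁ ^ 2 = 2 → S₂ ^ 2 = 2 + S₁ →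
      ∃ c : ℕ → R, φ y₀ + φ y₁ * S₁ + (φ y₂ + φ y₃ * S₁) * S₂ = ∑ k ∈ Finset.range (e₀ + 1), c k * φ q₀ ^ (e₀ - k) * (S₂ - (t : R)) ^ k)
    (hmem₁ : ∀ (R : Type) [CommRing R] (φ : 𝓞 ↥(IntermediateField.adjoin ℚ ({β} : Set (AlgebraicClosure ℚ))) →+* R) (S₁ S₂ : R), S₁ ^ 2 = 2 → S₂ ^ 2 = 2 + S₁ →
      ∃ c : ℕ → R, φ y₀ + φ y₁ * S₁ + (φ y₂ + φ y₃ * S₁) * S₂ = ∑ k ∈ Finset.range (e₁ + 1), c k * φ q₀ ^ (e₁ - k) * (S₁ * S₂ - S₂ - (t : R)) ^ k)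
    (hmem₂ : ∀ (R : Type) [CommRing R] (φ : 𝓞 ↥(IntermediateField.adjoin ℚ ({β} : Set (AlgebraicClosure ℚ))) →+* R) (S₁ S₂ : R), S₁ ^ 2 = 2 → S₂ ^ 2 = 2 + S₁ →
      ∃ c : ℕ → R, φ y₀ + φ y₁ * S₁ + (φ y₂ + φ y₃ * S₁) * S₂ = ∑ k ∈ Finset.range (e₂ + 1), c k * φ q₀ ^ (e₂ - k) * (-S₂ - (t : R)) ^ k)
    (hmem₃ : ∀ (R : Type) [CommRing R] (φ : 𝓞 ↥(IntermediateField.adjoin ℚ ({β} : Set (AlgebraicClosure ℚ))) →+* R) (S₁ S₂ : R), S₁ ^ 2 = 2 → S₂ ^ 2 = 2 + S₁ →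
      ∃ c : ℕ → R, φ y₀ + φ y₁ * S₁ + (φ y₂ + φ y₃ * S₁) * S₂ = ∑ k ∈ Finset.range (e₃ + 1), c k * φ q₀ ^ (e₃ - k) * (S₂ - S₁ * S₂ - (t : R)) ^ k)
    (εy : (𝓞 ↥(IntermediateField.adjoin ℚ ({β} : Set (AlgebraicClosure ℚ))))ˣ)
    (hNy : (y₀ ^ 2 + 2 * y₁ ^ 2 - 2 * y₂ ^ 2 - 4 * y₃ ^ 2 - 4 * y₂ * y₃) ^ 2 - 2 * (2 * y₀ * y₁ - y₂ ^ 2 - 2 * y₃ ^ 2 - 4 * y₂ * y₃) ^ 2 = εy * q₀ ^ n) :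
    (∀ m, classGroupPRank κP m ≤ d) ∧ ClassicalMuVanishes κP ∧ classicalLambda κP ≤ d := by
  have hirr := AlignedTransportAtTwoSeed.irr_two_of_forall_not_hasRationalTwoTorsionX W ht
  have hβint : IsIntegral ℚ β := ((AlgebraicClosure.isAlgebraic ℚ).isAlgebraic β).isIntegral
  haveI : FiniteDimensional ℚ ↥(IntermediateField.adjoin ℚ ({β} : Set (AlgebraicClosure ℚ))) := IntermediateField.adjoin.finiteDimensional hβint
  haveI : NumberField ↥(IntermediateField.adjoin ℚ ({β} : Set (AlgebraicClosure ℚ))) := NumberField.mk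
  haveI : Fact (Nat.Prime 2) := ⟨Nat.prime_two⟩
  have h3 : Module.finrank ℚ ↥(IntermediateField.adjoin ℚ ({β} : Set (AlgebraicClosure ℚ))) = 3 :=
    AddKatoTwo.finrank_adjoin_root_twoTorsionPolynomial_eq_three W hirr hβ
  have hodd3 : ¬ 2 ∣ Module.finrank ℚ ↥(IntermediateField.adjoin ℚ ({β} : Set (AlgebraicClosure ℚ))) := by rw [h3]; decide
  have hoddK : Odd (Module.finrank ℚ ↥(IntermediateField.adjoin ℚ ({β} : Set (AlgebraicClosure ℚ)))) :=
    Nat.odd_iff.mpr (Nat.two_dvd_ne_zero.mp hodd3)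
  have hrank : Units.rank ↥(IntermediateField.adjoin ℚ ({β} : Set (AlgebraicClosure ℚ))) = 1 :=
    units_rank_eq_one_of_nrRealPlaces_eq_one _ h3 (nrRealPlaces_adjoin_root_twoTorsionPolynomial_eq_one W hΔ hirr hβ)
  -- exactly three primes above `2` (`Δ_min ≡ 1 (mod 8)`: ON the Kilford stratum)
  have hs := (onKilfordStratumAtTwo_iff_minimalDiscriminantInt_emod_eight W hord).mpr h81
  have h3card := AlignedTransportAtTwoCubicKilfordPrimes.ncard_eq_three_of_onKilfordStratumAtTwo W hord ht hs h3
    (AlignedTransportAtTwoCubicKilfordPrimes.aeval_four_mul_gen_twoDivisionUCubic W hβ)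
  -- the dyadic prime `𝔭₁` of degree one; all units `≡ ±1 (mod 𝔭₁³)`
  obtain ⟨h𝔭₁, hP0, h2P, hcard⟩ := isPrime_and_mem_of_absNorm_eq_two 𝔭₁ hN
  haveI := h𝔭₁
  haveI : 𝔭₁.IsMaximal := h𝔭₁.isMaximal hP0
  have hres := forall_mem_or_sub_one_mem_of_card_quotient_eq_two 𝔭₁ hcard
  have h2P' : (2 : 𝓞 ↥(IntermediateField.adjoin ℚ ({β} : Set (AlgebraicClosure ℚ)))) ∉ 𝔭₁ ^ 2 := two_not_mem_sq_of_not_dvd_discr hd 𝔭₁ h2P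
  have hunits := forall_units_sub_one_mem_or_add_one_mem_of_rank_eq_one hoddK hrank 𝔭₁ hP0 hres h2P h2P' hε hnsq
  -- the dyadic prime `𝔭'` of degree one
  obtain ⟨h𝔭', hP0', h2P'', hcard'⟩ := isPrime_and_mem_of_absNorm_eq_two 𝔭' hN'
  haveI := h𝔭'
  haveI : 𝔭'.IsMaximal := h𝔭'.isMaximal hP0'
  have hres' := forall_mem_or_sub_one_mem_of_card_quotient_eq_two 𝔭' hcard'
  exact classicalMuVanishes_two_of_generalRelationCert_layer_two_of_sub_three_mem hodd3 hd κP hκP h3card.le hh 𝔭' hres' h2P'' hε' 𝔭₁ hres h2P hunits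
    q₀ hq₀ hπ t hq ψ hψ hti hPt α β' hBez α₁ v₁ hC₁ α₂ v₂ hC₂ α₃ v₃ hC₃ e₀ e₁ e₂ e₃ hn hd2 hu hF y₀ y₁ y₂ y₃ hmem₀ hmem₁ hmem₂ hmem₃ εy hNy

end Summit.BirchSwinnertonDyer.BirchSwinnertonDyer.Theorems.AlignedTransportAtTwoCubicSplitStratumLayerTwoGeneralRelationDoor

end
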